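import Summits.BirchSwinnertonDyer.BirchSwinnertonDyer.Theorems.RamifiedSevenEllipticUnitsIndexIffLeafOfFacts
import Summits.BirchSwinnertonDyer.BirchSwinnertonDyer.Theorems.RamifiedSevenEllipticUnitsMember79
import HarnessLib

set_option linter.dupNamespace false
set_option autoImplicit false

/-!
# Route `RamifiedSevenEllipticUnits` (rung K7r): the crux `EllipticUnitIndexSeven` (stmt-19143)
# INSTANTIATED at the census member outside the unit case, `305809c1 = 49a1^{(−79)}`, with crux #4
# discharged (`--supports 19143`)

Cell `bsd-cm`, seat `bsd-cm-k7r-c2` (gen 3). HONEST FRAMING: per-member FRONTIER banking; nothing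
here bears on the class statement and BSD is not proved by any of this. Gen 2's
`ellipticUnitIndexAt_c305809c1_of_strictControlAt` (p425603) took `(R-ctrl)@7` at the member as a
hypothesis; crux #4 is now the theorem `StrictControlSeven_proof` (k7r-c4, p429067), so:

* `ellipticUnitIndexAt_c305809c1`: `(R-EU)@7` at `[1, −1, 0, −13652, 758379]` granted Cassels,
  modularity, GZK (named facts), `hr1 : r_an = 1` [certified numerics: w = −1 exact, L′(E,1) =
  9.3856360647707981180926889252… > 0 (lane j043845 Arb ball ± 3.5e-30; this seat j252070 PARI
  lfun agrees to 30 digits)], hD = (U-D) `#Sel⁷ ∣ 7` [CERTIFIED-DATUM: exact 7-isogeny descent, kit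
  j250795/j250884, rerun j251322/j251325, census26 j251392/j251393] and hA = (U-A) `ord₇ #Ш_an = 0`
  [CERTIFIED-DATUM modulo Manin c₀ = 1 (Cremona opt_man DATA): Gross–Zagier Heegner-index
  certificate W-79A — lane level I j043845 (d″ = −47, −59: S = 16, 4ρ = 64, I_K″ odd part 1,
  Sha_an exact 1) and this seat's table-free engine B j252070 (d″ = −47, −59, −68: m = 8, 8, 16,
  v₇(I_K″) = 0, generator (262726/441, 129450721/9261) ∉ 7E(ℚ)+tors, Sha_an exact 1), memo
  HOME/bsd-cm-k7r-c2/g3/W79A-HEEGNER-INDEX.md eb4f7fb61b15b6f2].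
* `ellipticUnitIndexAt_c305809c1_iff_bsdp`: at this member the crux's instance ⟺ `BSD(W, 7)`,
  granted modularity, GZ I.(7.3), GZK, Cassels and `hr1`.

References: [Miller2011LMS] Def. 1.1; [Cassels1965ArithmeticVIII]; [GrossZagier1986] Thm. I.(7.3),
V.§2.
-/

noncomputable section

open scoped Classical

open WeierstrassCurve
  Literature.NumberTheory.EllipticCurves
  Literature.NumberTheory.EllipticCurves.Rank1Residual
  Summit.BirchSwinnertonDyer.Rank1Residual.X12
  Summit.BirchSwinnertonDyer.Rank1Residual.X12.O11
  Summit.BirchSwinnertonDyer.Rank1Residual.X12.O11.RouteU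

namespace Summit.BirchSwinnertonDyer.BirchSwinnertonDyer.Theorems.RamifiedSevenEllipticUnits

/-- **`(R-EU)@7` at `305809c1 = 49a1^{(−79)}`** (`[1, −1, 0, −13652, 758379]`) granted Cassels,
modularity, GZK, `r_an = 1` [certified numerics], hD = (U-D) [CERTIFIED-DATUM: census26
j251392/j251393, descent7 j250795/j250884 + j251322/j251325] and hA = (U-A) [CERTIFIED-DATUM modulo
Manin c₀ = 1 DATA: W-79A, lane j043845 + this seat j252070] — gen 3's `ellipticUnitIndexAt_seven_of_routeU`
at the member (crux #4 discharged inside). [cite: Miller2011LMS, §1 and Def. 1.1]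
[cite: Cassels1965ArithmeticVIII] -/
theorem ellipticUnitIndexAt_c305809c1 (hCassels : bsdRHS_eq_of_isIsogenous)
    (hmod : hasEntireLFunction_rat) (hGZK : rank_eq_analyticRank_of_analyticRank_le_one)
    (hr1 : (⟨1, -1, 0, -13652, 758379⟩ : WeierstrassCurve ℚ).analyticRank = 1)
    (hD : SelmerSevenBound (⟨1, -1, 0, -13652, 758379⟩ : WeierstrassCurve ℚ))
    (hA : ShaAnSevenUnit (⟨1, -1, 0, -13652, 758379⟩ : WeierstrassCurve ℚ)) :
    RamifiedCMEllipticUnitIndexAt (⟨1, -1, 0, -13652, 758379⟩ : WeierstrassCurve ℚ) 7 :=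
  ellipticUnitIndexAt_seven_of_routeU hCassels hmod hGZK (classCSeven_c305809c1 hr1) hD hA

/-- **At `305809c1`: `(R-EU)@7 ⟺ BSD(W, 7)`** granted modularity, Gross–Zagier I.(7.3), GZK, Cassels
and `r_an = 1` — gen 3's `ellipticUnitIndexAt_seven_iff_bsdp` at the member.
[cite: Miller2011LMS, §1 and Def. 1.1] [cite: GrossZagier1986, Thm. I.(7.3)] -/
theorem ellipticUnitIndexAt_c305809c1_iff_bsdp (hmod : hasEntireLFunction_rat)
    (hGZ : GrossZagier1986_thm_I_7_3) (hGZK : rank_eq_analyticRank_of_analyticRank_le_one)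
    (hCassels : bsdRHS_eq_of_isIsogenous)
    (hr1 : (⟨1, -1, 0, -13652, 758379⟩ : WeierstrassCurve ℚ).analyticRank = 1) :
    RamifiedCMEllipticUnitIndexAt (⟨1, -1, 0, -13652, 758379⟩ : WeierstrassCurve ℚ) 7 ↔
      BSDp (⟨1, -1, 0, -13652, 758379⟩ : WeierstrassCurve ℚ) 7 :=
  ellipticUnitIndexAt_seven_iff_bsdp hmod hGZ hGZK hCassels (classCSeven_c305809c1 hr1)

end Summit.BirchSwinnertonDyer.BirchSwinnertonDyer.Theorems.RamifiedSevenEllipticUnits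

end
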